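import Summits.Ventures.PercRepro.Night2LocalDyadic
import Summits.Ventures.PercRepro.Night2LocalTwoSplit

/-!
# PercRepro — the geometry of the line case (C1) at a plane (night-2, gen 7)

`G` a plane (rank-`3` flat), `F ⊆ G` a carrying line with `G ∖ F = {z}`, `M` loopless.  For a shadow set `S` with
closure `G` the members `B` of which `S` is an EXACT trace (`B ⊆ S`, `S ∩ cl B = B`) are read off the lines of
`G`: either `cl B = F` (then `S ∖ B = {z}`) or `z ∈ cl B` (then `z ∈ B`, and the PART `B.erase z ⊆ S.erase z`
is nonempty).  The parts of distinct such members are DISJOINT (`exact_parts_disjoint`: two distinct lines of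
`G` through `z` meet in a rank-`≤ 1` flat, which cannot contain `z` and a point of `F`), and a member whose line
misses a single element `y` of `G` is the only one (`exact_unique_of_card_one`: another one would be `{y, z}`,
whose complement lies in `(E ∖ G) ∪ (cl B ∩ F)`, of rank `≤ 3`).  `proofs/NIGHT-2-local.md` §7–§8 (C1).
-/

namespace PercRepro.Shadow

open Finset PerFlat ThmH

variable {α : Type*} [DecidableEq α] {M : Matroid α} [M.Finite]

/-! ## Exact traces and the lines of `G` -/

/-- The closure of an exact member of `S` is `F` or contains `z` (`G ∖ F = {z}`). -/
theorem exact_clF_eq_or_mem {q : ℕ} {𝒜 : Finset (Finset α)} (h𝒜 : 𝒜 ⊆ Uq M (q + 2) q) {G F : Finset α}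
    (hF : F ∈ flatsQ M q) {z : α} (hz : G \ F = {z}) {B : Finset α}
    (hB : B ∈ membersIn M 𝒜 G) : clF M B = F ∨ z ∈ clF M B := by
  by_cases hzB : z ∈ clF M B
  · exact Or.inr hzB
  · left
    have hBU : B ∈ Uq M (q + 2) q := h𝒜 (mem_membersIn.1 hB).1
    have hBG : clF M B ⊆ G := (mem_membersIn.1 hB).2
    apply flatsQ_eq_of_subset (clF_mem_flatsQ hBU) hF
    intro x hx
    by_contra hxF
    have : x ∈ G \ F := Finset.mem_sdiff.2 ⟨hBG hx, hxF⟩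
    rw [hz, Finset.mem_singleton] at this
    exact hzB (this ▸ hx)

/-- A shadow set with closure `G` contains `z` (otherwise it lies in `F`, of rank `q`). -/
theorem mem_of_mem_shadowAt {q : ℕ} {𝒜 : Finset (Finset α)} {G F : Finset α}
    (hF : F ∈ flatsQ M q) {z : α} (hz : G \ F = {z}) {S : Finset α} (hS : S ∈ shadowAt M (q + 2) q 𝒜 G) :
    z ∈ S := by
  by_contra hzS
  have hSG : S ⊆ G := subset_of_mem_shadowAt hS
  have hSF : S ⊆ F := by
    intro x hx
    by_contra hxF
    have : x ∈ G \ F := Finset.mem_sdiff.2 ⟨hSG hx, hxF⟩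
    rw [hz, Finset.mem_singleton] at this
    exact hzS (this ▸ hx)
  have hr := eRk_eq_of_mem_Yq_diag (shadow_subset_Yq _ (mem_shadowAt.1 hS).1)
  have h : M.eRk (S : Set α) ≤ (q : ℕ∞) := by
    rw [← (mem_flatsQ.1 hF).2.2]
    exact M.eRk_mono (by exact_mod_cast hSF)
  rw [hr] at h
  have : q + 1 ≤ q := by exact_mod_cast h
  omega

/-- An exact member of `S` with closure `F` has `S ∖ B = {z}`. -/
theorem sdiff_eq_singleton_of_exact {q : ℕ} {𝒜 : Finset (Finset α)} {G F : Finset α}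
    (hG : G ∈ flatsQ M (q + 1)) (hF : F ∈ flatsQ M q) {z : α} (hz : G \ F = {z}) {S B : Finset α}
    (hS : S ∈ shadowAt M (q + 2) q 𝒜 G) (hBS : B ⊆ S) (hSB : S ∩ clF M B = B) (hBF : clF M B = F) :
    S \ B = {z} := by
  have hzS := mem_of_mem_shadowAt (𝒜 := 𝒜) hF hz hS
  have hSG : S ⊆ G := subset_of_mem_shadowAt hS
  ext x
  rw [Finset.mem_sdiff, Finset.mem_singleton]
  constructor
  · rintro ⟨hxS, hxB⟩
    have hxF : x ∉ F := by
      intro hxF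
      apply hxB
      rw [← hSB, Finset.mem_inter, hBF]
      exact ⟨hxS, hxF⟩
    have : x ∈ G \ F := Finset.mem_sdiff.2 ⟨hSG hxS, hxF⟩
    rw [hz, Finset.mem_singleton] at this
    exact this
  · intro hxz
    rw [hxz]
    refine ⟨hzS, ?_⟩
    intro hzB
    have : z ∈ F := by
      rw [← hBF]
      exact subset_clF_of_subset_gr (hBS.trans (hSG.trans (mem_flatsQ.1 hG).1)) hzB
    have hz' : z ∈ G \ F := by rw [hz]; exact Finset.mem_singleton_self z
    exact (Finset.mem_sdiff.1 hz').2 this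

/-- An exact member of `S` whose closure contains `z` contains `z`. -/
theorem mem_of_exact {q : ℕ} {𝒜 : Finset (Finset α)} {G F : Finset α}
    (hF : F ∈ flatsQ M q) {z : α} (hz : G \ F = {z}) {S B : Finset α} (hS : S ∈ shadowAt M (q + 2) q 𝒜 G)
    (hSB : S ∩ clF M B = B) (hzB : z ∈ clF M B) : z ∈ B := by
  rw [← hSB, Finset.mem_inter]
  exact ⟨mem_of_mem_shadowAt (𝒜 := 𝒜) hF hz hS, hzB⟩

/-- The part of an exact member through `z` is nonempty (a member has rank `q ≥ 1`... here the rank of `{z}` is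
at most `1 < q + 1`, and `B` has rank `q`; we use `q = 2`: `B ≠ {z}` since `{z}` has rank `≤ 1 < 2`). -/
theorem part_nonempty {𝒜 : Finset (Finset α)} (h𝒜 : 𝒜 ⊆ Uq M (2 + 2) 2) {G : Finset α} {B : Finset α}
    (hB : B ∈ membersIn M 𝒜 G) {z : α} (hzB : z ∈ B) : (B.erase z).Nonempty := by
  rw [Finset.nonempty_iff_ne_empty]
  intro hempty
  have hBz : B = {z} := by
    rw [← Finset.insert_erase hzB, hempty]
    rfl
  have hBU : B ∈ Uq M (2 + 2) 2 := h𝒜 (mem_membersIn.1 hB).1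
  have hr := (mem_Uq.1 hBU).2.1
  rw [hBz, Finset.coe_singleton] at hr
  have h1 := M.eRk_singleton_le z
  rw [hr] at h1
  have : 2 ≤ 1 := by exact_mod_cast h1
  omega

/-! ## Disjointness of the parts -/

omit [DecidableEq α] in
/-- Two elements `x ∈ F`, `z ∉ F` with `{x}` independent span a set of rank `2`. -/
theorem two_le_eRk_pair {q : ℕ} {F : Finset α} (hF : F ∈ flatsQ M q) {x z : α} (hx : x ∈ F) (hz : z ∈ gr M)
    (hzF : z ∉ F) (hind : M.Indep {x}) : (2 : ℕ∞) ≤ M.eRk ({x, z} : Set α) := by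
  have hzE : z ∈ M.E \ M.closure ({x} : Set α) := by
    refine ⟨by rw [← coe_gr]; exact_mod_cast hz, ?_⟩
    intro hzx
    apply hzF
    have h1 : M.closure ({x} : Set α) ⊆ (F : Set α) := by
      rw [← (mem_flatsQ.1 hF).2.1.closure]
      exact M.closure_subset_closure (by simpa using hx)
    exact_mod_cast h1 hzx
  rw [Set.pair_comm, Matroid.eRk_insert_eq_add_one hzE, hind.eRk_eq_encard, Set.encard_singleton]
  norm_num

/-- **The parts of two distinct exact members through `z` are disjoint**: the two lines meet in a flat of rank
`≤ 1`, which cannot contain `z` together with an element of `F`. -/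
theorem exact_parts_disjoint {𝒜 : Finset (Finset α)} (h𝒜 : 𝒜 ⊆ Uq M (2 + 2) 2) {G F : Finset α}
    (hG : G ∈ flatsQ M (2 + 1)) (hF : F ∈ flatsQ M 2) {z : α} (hz : G \ F = {z})
    (hloop : ∀ e ∈ gr M, M.Indep {e}) {S B B' : Finset α}
    (hB : B ∈ membersIn M 𝒜 G) (hSB : S ∩ clF M B = B) (hzB : z ∈ clF M B)
    (hB' : B' ∈ membersIn M 𝒜 G) (hSB' : S ∩ clF M B' = B') (hzB' : z ∈ clF M B') (hne : B ≠ B') :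
    Disjoint (B.erase z) (B'.erase z) := by
  have hBU : B ∈ Uq M (2 + 2) 2 := h𝒜 (mem_membersIn.1 hB).1
  have hB'U : B' ∈ Uq M (2 + 2) 2 := h𝒜 (mem_membersIn.1 hB').1
  have hGg : G ⊆ gr M := (mem_flatsQ.1 hG).1
  have hFne : clF M B ≠ clF M B' := by
    intro h
    apply hne
    rw [← hSB, ← hSB', h]
  have hzG : z ∈ G := by
    have : z ∈ G \ F := by rw [hz]; exact Finset.mem_singleton_self z
    exact (Finset.mem_sdiff.1 this).1
  have hzF : z ∉ F := by
    have : z ∈ G \ F := by rw [hz]; exact Finset.mem_singleton_self z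
    exact (Finset.mem_sdiff.1 this).2
  rw [Finset.disjoint_left]
  intro x hx hx'
  rw [Finset.mem_erase] at hx hx'
  -- x ∈ F (x ∈ G, x ≠ z)
  have hxG : x ∈ G := (mem_membersIn.1 hB).2 (subset_clF hBU hx.2)
  have hxF : x ∈ F := by
    by_contra hxF
    have : x ∈ G \ F := Finset.mem_sdiff.2 ⟨hxG, hxF⟩
    rw [hz, Finset.mem_singleton] at this
    exact hx.1 this
  -- {x, z} ⊆ cl B ∩ cl B', of rank ≤ 1
  have hsub : ({x, z} : Finset α) ⊆ clF M B ∩ clF M B' :=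
    Finset.insert_subset (Finset.mem_inter.2 ⟨subset_clF hBU hx.2, subset_clF hB'U hx'.2⟩)
      (Finset.singleton_subset_iff.2 (Finset.mem_inter.2 ⟨hzB, hzB'⟩))
  have h1 := eRk_inter_le_of_ne (clF_mem_flatsQ hBU) (clF_mem_flatsQ hB'U) hFne
  have h2 := two_le_eRk_pair hF hxF (hGg hzG) hzF (hloop x (hGg hxG))
  have h3 : M.eRk (({x, z} : Finset α) : Set α) ≤ M.eRk ((clF M B ∩ clF M B' : Finset α) : Set α) :=
    M.eRk_mono (by exact_mod_cast hsub)
  rw [Finset.coe_pair] at h3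
  have h4 : (2 : ℕ∞) + 1 ≤ (2 : ℕ∞) := by
    calc (2 : ℕ∞) + 1 ≤ M.eRk ((clF M B ∩ clF M B' : Finset α) : Set α) + 1 :=
          add_le_add (h2.trans h3) (le_refl 1)
      _ ≤ ((2 : ℕ) : ℕ∞) := h1
      _ = 2 := by norm_num
  have : (3 : ℕ) ≤ 2 := by exact_mod_cast h4
  omega

/-! ## A member whose line misses a single element is alone -/

/-- **A member whose line misses a single element `y` of `G` is the only exact member through `z`**: another
one would be `{y, z}`, whose complement lies in `(E ∖ G) ∪ (cl B₁ ∩ F)`, of rank `≤ 2 + 1`. -/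
theorem exact_unique_of_card_one {𝒜 : Finset (Finset α)} (h𝒜 : 𝒜 ⊆ Uq M (2 + 2) 2) {G F : Finset α}
    (hG : G ∈ flatsQ M (2 + 1)) (hF : F ∈ flatsQ M 2) (hd : (gr M \ G).card = 2) {z : α}
    (hz : G \ F = {z}) (hloop : ∀ e ∈ gr M, M.Indep {e}) {S B₁ B₂ : Finset α}
    (hS : S ∈ shadowAt M (2 + 2) 2 𝒜 G)
    (hB₁ : B₁ ∈ membersIn M 𝒜 G) (hSB₁ : S ∩ clF M B₁ = B₁) (hzB₁ : z ∈ clF M B₁)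
    (hc₁ : (G \ clF M B₁).card = 1)
    (hB₂ : B₂ ∈ membersIn M 𝒜 G) (hSB₂ : S ∩ clF M B₂ = B₂) (hzB₂ : z ∈ clF M B₂) : B₂ = B₁ := by
  by_contra hne
  have hB₁U : B₁ ∈ Uq M (2 + 2) 2 := h𝒜 (mem_membersIn.1 hB₁).1
  have hB₂U : B₂ ∈ Uq M (2 + 2) 2 := h𝒜 (mem_membersIn.1 hB₂).1
  have hGg : G ⊆ gr M := (mem_flatsQ.1 hG).1
  obtain ⟨y, hy⟩ := Finset.card_eq_one.1 hc₁
  have hdisj := exact_parts_disjoint h𝒜 hG hF hz hloop (S := S) hB₂ hSB₂ hzB₂ hB₁ hSB₁ hzB₁ hne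
  have hz₂ : z ∈ B₂ := mem_of_exact hF hz hS hSB₂ hzB₂
  have hpart := part_nonempty h𝒜 hB₂ hz₂
  -- the part of B₂ lies in G ∖ cl B₁ = {y}
  have hsub : B₂.erase z ⊆ {y} := by
    intro x hx
    rw [Finset.mem_erase] at hx
    rw [← hy, Finset.mem_sdiff]
    refine ⟨(mem_membersIn.1 hB₂).2 (subset_clF hB₂U hx.2), ?_⟩
    intro hxB₁
    have hxS : x ∈ S := by rw [← hSB₂] at hx; exact (Finset.mem_inter.1 hx.2).1
    have hxB₁' : x ∈ B₁ := by rw [← hSB₁]; exact Finset.mem_inter.2 ⟨hxS, hxB₁⟩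
    have hx₁ : x ∈ B₁.erase z := Finset.mem_erase.2 ⟨hx.1, hxB₁'⟩
    exact Finset.disjoint_left.1 hdisj (Finset.mem_erase.2 hx) hx₁
  have hB₂eq : B₂ = {y, z} := by
    obtain ⟨x, hx⟩ := hpart
    have hxy : x = y := Finset.mem_singleton.1 (hsub hx)
    have herase : B₂.erase z = {y} := by
      apply Finset.eq_of_subset_of_card_le hsub
      rw [Finset.card_singleton]
      exact Finset.card_pos.2 ⟨x, hx⟩
    rw [← Finset.insert_erase hz₂, herase]
    rw [Finset.pair_comm]
  -- E ∖ B₂ ⊆ (E ∖ G) ∪ (cl B₁ ∩ F), of rank ≤ 2 + 1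
  have hyG : y ∈ G := by
    have : y ∈ G \ clF M B₁ := by rw [hy]; exact Finset.mem_singleton_self y
    exact (Finset.mem_sdiff.1 this).1
  have hcompl : gr M \ B₂ ⊆ (gr M \ G) ∪ (clF M B₁ ∩ F) := by
    intro x hx
    rw [Finset.mem_sdiff] at hx
    rw [Finset.mem_union, Finset.mem_inter]
    by_cases hxG : x ∈ G
    · right
      rw [hB₂eq, Finset.mem_insert, Finset.mem_singleton] at hx
      have hxy : x ≠ y := fun h => hx.2 (Or.inl h)
      have hxz : x ≠ z := fun h => hx.2 (Or.inr h)
      refine ⟨?_, ?_⟩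
      · by_contra hxB₁
        have : x ∈ G \ clF M B₁ := Finset.mem_sdiff.2 ⟨hxG, hxB₁⟩
        rw [hy, Finset.mem_singleton] at this
        exact hxy this
      · by_contra hxF
        have : x ∈ G \ F := Finset.mem_sdiff.2 ⟨hxG, hxF⟩
        rw [hz, Finset.mem_singleton] at this
        exact hxz this
    · exact Or.inl (Finset.mem_sdiff.2 ⟨hx.1, hxG⟩)
  have hFne : clF M B₁ ≠ F := by
    intro h
    have : z ∈ F := by rw [← h]; exact hzB₁
    have hz' : z ∈ G \ F := by rw [hz]; exact Finset.mem_singleton_self z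
    exact (Finset.mem_sdiff.1 hz').2 this
  have hr1 := eRk_inter_le_of_ne (clF_mem_flatsQ hB₁U) hF hFne
  have hr2 : M.eRk ((gr M \ G : Finset α) : Set α) ≤ 2 := by
    calc M.eRk ((gr M \ G : Finset α) : Set α) ≤ ((gr M \ G : Finset α) : Set α).encard := M.eRk_le_encard _
      _ = 2 := by rw [Set.encard_coe_eq_coe_finsetCard, hd]; rfl
  apply false_of_compl_subset hB₂U hcompl
  rw [Finset.coe_union]
  calc M.eRk (((gr M \ G : Finset α) : Set α) ∪ ((clF M B₁ ∩ F : Finset α) : Set α))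
      ≤ M.eRk ((gr M \ G : Finset α) : Set α) + M.eRk ((clF M B₁ ∩ F : Finset α) : Set α) :=
        M.eRk_union_le_eRk_add_eRk _ _
    _ ≤ 2 + M.eRk ((clF M B₁ ∩ F : Finset α) : Set α) := add_le_add hr2 (le_refl _)
    _ ≤ 2 + 1 := by
        have : M.eRk ((clF M B₁ ∩ F : Finset α) : Set α) ≤ 1 := by
          have h := hr1
          obtain ⟨n, hn⟩ := ENat.ne_top_iff_exists.1
            (ne_top_of_le_ne_top (ENat.coe_ne_top 2) (le_trans (le_add_right le_rfl) h))
          rw [← hn] at h ⊢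
          have h' : n + 1 ≤ 2 := by exact_mod_cast h
          have h'' : n ≤ 1 := by omega
          exact_mod_cast h''
        exact add_le_add (le_refl _) this
    _ = ((2 + 1 : ℕ) : ℕ∞) := by norm_num

end PercRepro.Shadow
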